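import Mathlib
import Literature.NumberTheory.Irrationality.BrownZudilin2022.BarnesRepresentation
import Summits.KontsevichZagierPeriods.Zeta5Search.Brown8.XStarOrbitCover
import Summits.KontsevichZagierPeriods.Zeta5Search.InvarianceOfConverges
import HarnessLib

/-!
# ζ(5) search — Brown–Zudilin's invariance (27) for the WHOLE group `G ≅ Σ₇` on the AMPLE locus (cell `pub-zeta5`, seat ct-1 g15)

HONEST FRAMING: systematic search; no irrationality claim unless kernel-certified. Nothing in this file is an
irrationality result, a worthiness exponent or a denominator statement; no value of any integral is computed.

The tree types Brown–Zudilin's invariance (27) [BrownZudilin2022, Sect. 7] in two forms: per GENERATOR on common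
domains of convergence (`BrownZudilin2022.invariance_of_converges'`, now a theorem:
`InvarianceOfConverges.invariance_of_converges'_holds`, ct-1 g10/g12/g13) and for the whole GROUP `G ≅ Σ₇` acting on the
exponent vectors `a ∈ ℤ⁸` through the dual slots by `slotPerm σ` (`BrownZudilin2022.invariance_group`, a named fact of
`BarnesRepresentation.lean`). This file proves the group form ON THE AMPLE LOCUS — all 28 linear forms `h₁,…,h₂₈` of (26)
non-negative, equivalently the whole `Σ₇`-orbit convergent — by FINITE CHAINING of the generator form along an explicit
word for `σ` (every intermediate vector of the chain is ample, hence convergent):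

* `slotPerm_one`, `slotPerm_mul` — `slotPerm` is a left action of `Equiv.Perm (Fin 7)`;
* `applyWord_eq_slotPerm`, `swapTable_spec`, `word_exists` — every `σ ∈ Σ₇` is a word in the five typed generators
  (`i₁ = (0 3)(1 2)(4 6)`, `p₀₁ = (2 3)`, `p₁₂ = (2 4)`, `h = (2 5)`, `h' = (3 5)` on `Fin 7`, index `j ↔` dual slot `b_{j+1}`;
  the tree's `slotPerm_i1 … slotPerm_h'`);
* `Ample`, `ample_chain`, `ample_slotPerm`, `ample_iff_orbit` — the ample locus, its `Σ₇`-stability, ample ⟺ orbit-convergent;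
* **`normalisedIntegral'_slotPerm_of_ample`** — for every `σ ∈ Σ₇` and every ample `a`:
  `I(σ·a)/∏_{i∈F} h_i(σ·a)! = I(a)/∏_{i∈F} h_i(a)!` (unconditional), and `invariance_group_on_ample`;
* `slotPerm_add_const`, `hList_add_const`, `ample_add_const` — the `G`-fixed direction `(1,…,1)`: `σ·(a + c·𝟙) = σ·a + c·𝟙`,
  `h_i(a + c·𝟙) = h_i(a) + c`, and every `a` becomes ample after a translation by `c·𝟙`, `c ≥ -min_i h_i(a)` (the input of the
  sequel `InvarianceGroup.lean`, which removes the ampleness hypothesis by a moment argument along this direction).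

OFF the ample locus integer chaining can fail (denom-theory-d3 g27's kernel example `x = (17,0,8,1,6,2,0,5)`, `(1 5)·x`: both
convergent, no convergent chain of generators joins them), so this file alone does NOT discharge `invariance_group`.
Sections 1–4 are the port of the cell's scratch file `denom-law/code/d3g28/lean/AmpleGroupInvariance.lean` (denom-theory-d3 g28,
2026-08-23, kernel-checked there with (27) per generator as a hypothesis), with that hypothesis discharged by
`invariance_of_converges'_holds`. One new definition (`Ample`, a decidable predicate on `ℤ⁸`); theorems otherwise.
-/

namespace Summit.KontsevichZagierPeriods.Zeta5Search.AmpleGroupInvariance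

open Literature.NumberTheory.Irrationality
open Literature.NumberTheory.Irrationality.BrownZudilin2022
open Summit.KontsevichZagierPeriods.Zeta5Search.Families.Cellular
open Summit.KontsevichZagierPeriods.Zeta5Search.Families.Cellular.XStarCover
open Summit.KontsevichZagierPeriods.Zeta5Search.InvarianceOfConverges (invariance_of_converges'_holds)
open Equiv

/-! ### 1. `slotPerm` is a left action of `Σ₇` -/

/-- The permutation of the dual slots `1,…,7` underlying `slotPerm`: `(σ·b)_j = b_{σ⁻¹ j}`; `b₀` and `j ≥ 8` untouched.
[BrownZudilin2022, Sect. 8] -/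
def permB (σ : Perm (Fin 7)) (b : ℕ → ℤ) (j : ℕ) : ℤ :=
  if h : 1 ≤ j ∧ j ≤ 7 then b ((σ.symm ⟨j - 1, by omega⟩ : Fin 7) + 1) else b j

/-- `slotPerm σ a = a(σ·b(a))` (definitional unfolding through `permB`). -/
theorem slotPerm_def (σ : Perm (Fin 7)) (a : Fin 8 → ℤ) : slotPerm σ a = aOfB (permB σ (bOfA a)) := rfl

/-- `b(a(b')) = b'` on the slots `0,…,7`. -/
theorem bOfA_aOfB (b : ℕ → ℤ) (j : ℕ) (hj : j ≤ 7) : bOfA (aOfB b) j = b j := by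
  interval_cases j <;> simp [bOfA, aOfB] <;> ring

/-- `a(b)` reads only the slots `0,…,7`. -/
theorem aOfB_congr {b b' : ℕ → ℤ} (h : ∀ j, j ≤ 7 → b j = b' j) : aOfB b = aOfB b' := by
  simp only [aOfB, h 0 (by norm_num), h 1 (by norm_num), h 2 (by norm_num), h 3 (by norm_num), h 4 (by norm_num),
    h 5 (by norm_num), h 6 (by norm_num), h 7 (by norm_num)]

/-- On the slots `0,…,7`, `permB σ b` reads `b` only on the slots `0,…,7`. -/
theorem permB_congr (σ : Perm (Fin 7)) {b b' : ℕ → ℤ} (h : ∀ j, j ≤ 7 → b j = b' j) :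
    ∀ j, j ≤ 7 → permB σ b j = permB σ b' j := by
  intro j hj
  unfold permB
  split_ifs with h1
  · have hk := (σ.symm ⟨j - 1, by omega⟩).isLt
    exact h _ (by omega)
  · exact h j hj

/-- Index bookkeeping: `⟨(k+1)-1, _⟩ = k` in `Fin 7`. -/
theorem fin7_succ_pred (k : Fin 7) (h : (k : ℕ) + 1 - 1 < 7) : (⟨(k : ℕ) + 1 - 1, h⟩ : Fin 7) = k := Fin.ext (by simp)

/-- `(στ)⁻¹ x = τ⁻¹ (σ⁻¹ x)`. -/
theorem mul_symm_apply (σ τ : Perm (Fin 7)) (x : Fin 7) : (σ * τ).symm x = τ.symm (σ.symm x) := rfl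

/-- `permB` composes like a left action. -/
theorem permB_mul (σ τ : Perm (Fin 7)) (b : ℕ → ℤ) (j : ℕ) : permB σ (permB τ b) j = permB (σ * τ) b j := by
  unfold permB
  split_ifs with h1 h2
  · simp only [fin7_succ_pred, mul_symm_apply]
  · exfalso
    have hk := (σ.symm ⟨j - 1, by omega⟩).isLt
    omega
  · rfl

/-- `slotPerm 1 = id`. -/
theorem slotPerm_one (a : Fin 8 → ℤ) : slotPerm 1 a = a := by
  rw [slotPerm_def]
  conv_rhs => rw [← aOfB_bOfA a]
  apply aOfB_congr
  intro j hj
  unfold permB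
  split_ifs with h1
  · show bOfA a (((1 : Perm (Fin 7)).symm ⟨j - 1, _⟩ : ℕ) + 1) = bOfA a j
    congr 1
    simp only [Equiv.Perm.one_def, Equiv.refl_symm, Equiv.refl_apply, Fin.val_mk]
    omega
  · rfl

/-- **`slotPerm` is a left action**: `(στ)·a = σ·(τ·a)`. [BrownZudilin2022, Sect. 8 (`G ≅ Σ₇`)] -/
theorem slotPerm_mul (σ τ : Perm (Fin 7)) (a : Fin 8 → ℤ) : slotPerm (σ * τ) a = slotPerm σ (slotPerm τ a) := by
  simp only [slotPerm_def]
  apply aOfB_congr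
  intro j hj
  rw [← permB_mul]
  exact permB_congr σ (fun k hk => (bOfA_aOfB _ k hk).symm) j hj

/-! ### 2. Words in the five generators -/

/-- The slot permutations of the five typed generators, in the order of `applyGen`:
`i₁ = (0 3)(1 2)(4 6)`, `p₀₁ = (2 3)`, `p₁₂ = (2 4)`, `h = (2 5)`, `h' = (3 5)`. [BrownZudilin2022, Sect. 7–8] -/
def genPerm : Fin 5 → Perm (Fin 7) := ![swap 0 3 * swap 1 2 * swap 4 6, swap 2 3, swap 2 4, swap 2 5, swap 3 5]

/-- Each typed generator is `slotPerm` of its slot permutation (the tree's `slotPerm_i1 … slotPerm_h'`). -/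
theorem applyGen_eq_slotPerm (i : Fin 5) (a : Fin 8 → ℤ) : applyGen i a = slotPerm (genPerm i) a := by
  fin_cases i
  · exact (slotPerm_i1 a).symm
  · exact (slotPerm_p01 a).symm
  · exact (slotPerm_p12 a).symm
  · exact (slotPerm_h a).symm
  · exact (slotPerm_h' a).symm

/-- The slot permutation of a word (first letter applied first, as `applyWord`). -/
def wordPerm : List (Fin 5) → Perm (Fin 7)
  | [] => 1
  | i :: w => wordPerm w * genPerm i

/-- **A word acts as `slotPerm` of its slot permutation.** -/
theorem applyWord_eq_slotPerm (w : List (Fin 5)) : ∀ a : Fin 8 → ℤ, applyWord w a = slotPerm (wordPerm w) a := by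
  induction w with
  | nil => intro a; exact (slotPerm_one a).symm
  | cons i w ih =>
    intro a
    show applyWord w (applyGen i a) = slotPerm (wordPerm w * genPerm i) a
    rw [ih, applyGen_eq_slotPerm, slotPerm_mul]

/-- `wordPerm` of a concatenation. -/
theorem wordPerm_append (u v : List (Fin 5)) : wordPerm (u ++ v) = wordPerm v * wordPerm u := by
  induction u with
  | nil => simp [wordPerm]
  | cons i u ih => simp [wordPerm, ih, mul_assoc]

/-- Shortest words (BFS over the Cayley graph; total 89 letters, max length 9; cell file `denom-law/code/d3g28/words.py`)
for the 21 transpositions of `Fin 7`; row `x`, entry `y` is a word for `swap x y` (`[]` on the diagonal). -/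
def swapTable : Fin 7 → Fin 7 → List (Fin 5) :=
  ![![[], [0, 1, 0], [3, 0, 4, 0, 3], [4, 0, 4, 0, 4], [2, 3, 0, 4, 0, 3, 2], [0, 4, 0], [0, 1, 2, 1, 0]],
    ![[0, 1, 0], [], [3, 0, 3, 0, 3], [4, 0, 3, 0, 4], [2, 3, 0, 3, 0, 3, 2], [0, 3, 0], [0, 2, 0]],
    ![[3, 0, 4, 0, 3], [3, 0, 3, 0, 3], [], [1], [2], [3], [3, 0, 2, 3, 2, 0, 3]],
    ![[4, 0, 4, 0, 4], [4, 0, 3, 0, 4], [1], [], [1, 2, 1], [4], [4, 0, 2, 3, 2, 0, 4]],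
    ![[2, 3, 0, 4, 0, 3, 2], [2, 3, 0, 3, 0, 3, 2], [2], [1, 2, 1], [], [2, 3, 2], [2, 3, 0, 2, 3, 2, 0, 3, 2]],
    ![[0, 4, 0], [0, 3, 0], [3], [4], [2, 3, 2], [], [0, 2, 3, 2, 0]],
    ![[0, 1, 2, 1, 0], [0, 2, 0], [3, 0, 2, 3, 2, 0, 3], [4, 0, 2, 3, 2, 0, 4], [2, 3, 0, 2, 3, 2, 0, 3, 2], [0, 2, 3, 2, 0], []]]

/-- Every transposition of the dual slots is an explicit word in the five generators (kernel `decide`). -/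
theorem swapTable_spec : ∀ x y : Fin 7, x ≠ y → wordPerm (swapTable x y) = swap x y := by decide

/-- **Every `σ ∈ Σ₇` is a word in the five typed generators** (cf. the tree's `CellularGroup.closure_eq_top`).
[BrownZudilin2022, Sect. 8: "G is naturally isomorphic to Σ₇"] -/
theorem word_exists (σ : Perm (Fin 7)) : ∃ w : List (Fin 5), wordPerm w = σ := by
  induction σ using Equiv.Perm.swap_induction_on with
  | one => exact ⟨[], rfl⟩
  | swap_mul f x y hxy ih =>
    obtain ⟨w, hw⟩ := ih
    exact ⟨w ++ swapTable x y, by rw [wordPerm_append, swapTable_spec x y hxy, hw]⟩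

/-- Hence every `σ·a` is reached from `a` by a word. -/
theorem slotPerm_eq_applyWord (σ : Perm (Fin 7)) (a : Fin 8 → ℤ) : ∃ w : List (Fin 5), applyWord w a = slotPerm σ a := by
  obtain ⟨w, rfl⟩ := word_exists σ
  exact ⟨w, applyWord_eq_slotPerm w a⟩

/-! ### 3. The ample locus -/

/-- The AMPLE locus: all 28 linear forms `h₁,…,h₂₈` of (26) are non-negative (equivalently `b_j(a) ≥ 0` for `j = 1..7` and
`b_j + b_k ≤ b₀` for all `j < k`; the `Σ₇`-closure of the seventeen convergence conditions (3)). [BrownZudilin2022, Sect. 7, (26)] -/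
def Ample (a : Fin 8 → ℤ) : Prop := ∀ x ∈ hList a, 0 ≤ x

/-- `Ample a` is decidable (a finite list of integer inequalities). -/
instance (a : Fin 8 → ℤ) : Decidable (Ample a) := by unfold Ample; infer_instance

/-- `Ample a` unfolded into the 28 inequalities. -/
theorem ample_iff (a : Fin 8 → ℤ) : Ample a ↔
    (0 ≤ a 0 ∧ 0 ≤ a 1 ∧ 0 ≤ a 2 ∧ 0 ≤ a 3 ∧ 0 ≤ a 4 ∧ 0 ≤ a 5 ∧ 0 ≤ a 6 ∧ 0 ≤ a 7 ∧
     0 ≤ a 0 + a 1 - a 3 ∧ 0 ≤ a 0 + a 4 - a 2 ∧ 0 ≤ a 0 + a 7 - a 2 ∧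
     0 ≤ a 1 + a 2 - a 4 ∧ 0 ≤ a 1 + a 2 - a 7 ∧ 0 ≤ a 2 + a 5 - a 7 ∧
     0 ≤ a 2 + a 3 - a 0 ∧ 0 ≤ a 3 + a 4 - a 1 ∧ 0 ≤ a 3 + a 7 - a 5 ∧
     0 ≤ a 3 + a 7 - a 1 ∧ 0 ≤ a 4 + a 5 - a 7 ∧ 0 ≤ a 6 + a 7 - a 5 ∧
     0 ≤ a 0 + a 1 + a 5 - a 3 - a 7 ∧ 0 ≤ a 0 + a 6 + a 7 - a 2 - a 5 ∧
     0 ≤ a 1 + a 2 + a 5 - a 3 - a 7 ∧ 0 ≤ a 1 + a 2 + a 5 - a 6 - a 7 ∧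
     0 ≤ a 3 + a 4 + a 7 - a 1 - a 2 ∧ 0 ≤ a 3 + a 6 + a 7 - a 1 - a 5 ∧
     0 ≤ a 3 + a 6 + 2 * a 7 - a 1 - a 2 - a 5 ∧ 0 ≤ a 3 + a 4 + a 6 + a 7 - a 1 - a 2 - a 5) := by
  unfold Ample hList
  simp only [List.mem_cons, List.not_mem_nil, or_false, forall_eq_or_imp, forall_eq]

/-- Ample vectors converge (the 17 forms (3) are among the 28). [BrownZudilin2022, Sect. 7, Remark 3] -/
theorem ample_converges {a : Fin 8 → ℤ} (h : Ample a) : Converges a := by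
  rw [ample_iff] at h
  rw [converges_iff]
  omega

/-- The ample locus is stable under `i₁`. -/
theorem ample_genI1 {a : Fin 8 → ℤ} (h : Ample a) : Ample (genI1 a) := by
  rw [ample_iff] at h ⊢; simp only [genI1, Matrix.cons_val]; omega

/-- The ample locus is stable under `p₀₁`. -/
theorem ample_genP01 {a : Fin 8 → ℤ} (h : Ample a) : Ample (genP01 a) := by
  rw [ample_iff] at h ⊢; simp only [genP01, Matrix.cons_val]; omega

/-- The ample locus is stable under `p₁₂`. -/
theorem ample_genP12 {a : Fin 8 → ℤ} (h : Ample a) : Ample (genP12 a) := by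
  rw [ample_iff] at h ⊢; simp only [genP12, Matrix.cons_val]; omega

/-- The ample locus is stable under `h`. -/
theorem ample_genH {a : Fin 8 → ℤ} (h : Ample a) : Ample (genH a) := by
  rw [ample_iff] at h ⊢; simp only [genH, Matrix.cons_val]; omega

/-- The ample locus is stable under `h'`. -/
theorem ample_genH' {a : Fin 8 → ℤ} (h : Ample a) : Ample (genH' a) := by
  rw [ample_iff] at h ⊢; simp only [genH', Matrix.cons_val]; omega

/-- The ample locus is stable under the five generators. -/
theorem ample_applyGen (i : Fin 5) {a : Fin 8 → ℤ} (h : Ample a) : Ample (applyGen i a) := by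
  fin_cases i
  · exact ample_genI1 h
  · exact ample_genP01 h
  · exact ample_genP12 h
  · exact ample_genH h
  · exact ample_genH' h

/-- The ample locus is stable under every word. -/
theorem ample_applyWord {a : Fin 8 → ℤ} (h : Ample a) (w : List (Fin 5)) : Ample (applyWord w a) := by
  induction w generalizing a with
  | nil => exact h
  | cons i w ih => exact ih (ample_applyGen i h)

/-- **From an ample vector every word is a convergent chain.** -/
theorem ample_chain {a : Fin 8 → ℤ} (h : Ample a) (w : List (Fin 5)) : ConvergentChain w a := by
  induction w generalizing a with
  | nil => exact (convergentChain_nil a).2 (ample_converges h)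
  | cons i w ih => exact (convergentChain_cons i w a).2 ⟨ample_converges h, ih (ample_applyGen i h)⟩

/-- The ample locus is `Σ₇`-stable … -/
theorem ample_slotPerm (σ : Perm (Fin 7)) {a : Fin 8 → ℤ} (h : Ample a) : Ample (slotPerm σ a) := by
  obtain ⟨w, hw⟩ := slotPerm_eq_applyWord σ a
  rw [← hw]
  exact ample_applyWord h w

/-- … so the whole orbit of an ample vector converges. -/
theorem converges_slotPerm_of_ample (σ : Perm (Fin 7)) {a : Fin 8 → ℤ} (h : Ample a) : Converges (slotPerm σ a) :=
  ample_converges (ample_slotPerm σ h)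

/-- The slot involution `(12)(34)` in `a`-coordinates. -/
theorem slotPerm_s12s34 (a : Fin 8 → ℤ) : slotPerm (swap (0 : Fin 7) 1 * swap (2 : Fin 7) 3) a =
    ![a 0, -a 0 + a 2 + a 3, a 0 - a 2 + a 4, a 1 + a 2 - a 4, a 4, a 5, a 6, -a 1 - a 2 + a 3 + a 4 + a 7] := by
  ext i; fin_cases i <;>
    simp [slotPerm, aOfB, bOfA, Equiv.Perm.mul_def, Equiv.symm_swap, Equiv.swap_apply_def] <;> ring

/-- The slot involution `(25)(36)` in `a`-coordinates. -/
theorem slotPerm_s25s36 (a : Fin 8 → ℤ) : slotPerm (swap (1 : Fin 7) 4 * swap (2 : Fin 7) 5) a =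
    ![a 0 - a 2 + a 7, a 1 + a 2 - a 7, a 5, a 3 - a 5 + a 7, a 4 + a 5 - a 7, a 2, -a 5 + a 6 + a 7, a 2 + a 5 - a 7] := by
  ext i; fin_cases i <;>
    simp [slotPerm, aOfB, bOfA, Equiv.Perm.mul_def, Equiv.symm_swap, Equiv.swap_apply_def] <;> ring

/-- The slot transposition `(27)` in `a`-coordinates. -/
theorem slotPerm_s27 (a : Fin 8 → ℤ) : slotPerm (swap (1 : Fin 7) 6) a =
    ![a 0 - a 2 - a 5 + a 6 + a 7, a 1 + a 2 + a 5 - a 6 - a 7, -a 5 + a 6 + a 7, a 3, a 4, a 5, a 2 + a 5 - a 7, a 7] := by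
  ext i; fin_cases i <;>
    simp [slotPerm, aOfB, bOfA, Equiv.symm_swap, Equiv.swap_apply_def] <;> ring

/-- **Ample ⟺ four orbit points converge** (`a` itself and its images under `(12)(34)`, `(25)(36)`, `(27)`). -/
theorem ample_iff_four (a : Fin 8 → ℤ) : Ample a ↔
    Converges a ∧ Converges (slotPerm (swap (0 : Fin 7) 1 * swap (2 : Fin 7) 3) a) ∧
      Converges (slotPerm (swap (1 : Fin 7) 4 * swap (2 : Fin 7) 5) a) ∧ Converges (slotPerm (swap (1 : Fin 7) 6) a) := by
  rw [ample_iff, slotPerm_s12s34, slotPerm_s25s36, slotPerm_s27, converges_iff, converges_iff, converges_iff, converges_iff]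
  simp only [Matrix.cons_val]
  omega

/-- **Ample ⟺ the whole `Σ₇`-orbit converges.** -/
theorem ample_iff_orbit (a : Fin 8 → ℤ) : Ample a ↔ ∀ σ : Perm (Fin 7), Converges (slotPerm σ a) := by
  constructor
  · intro h σ; exact converges_slotPerm_of_ample σ h
  · intro h
    rw [ample_iff_four]
    exact ⟨by simpa [slotPerm_one] using h 1, h _, h _, h _⟩

/-! ### 4. (27) for the whole group on the ample locus -/

/-- **Brown–Zudilin's invariance (27) for EVERY `σ ∈ Σ₇` at an ample vector** (unconditional; per-generator form by
`invariance_of_converges'_holds`, chained along a word for `σ`): `I(σ·a)/∏_{i∈F} h_i(σ·a)! = I(a)/∏_{i∈F} h_i(a)!`.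
[BrownZudilin2022, Sect. 7, eq. (27); Sect. 8] -/
theorem normalisedIntegral'_slotPerm_of_ample (σ : Perm (Fin 7)) {a : Fin 8 → ℤ} (hA : Ample a) :
    normalisedIntegral' (slotPerm σ a) = normalisedIntegral' a := by
  obtain ⟨w, hw⟩ := slotPerm_eq_applyWord σ a
  rw [← hw]
  exact normalisedIntegral'_chain invariance_of_converges'_holds w a (ample_chain hA w)

/-- `invariance_group` (the tree's named fact, verbatim shape) RESTRICTED to ample `a` (its second convergence hypothesis is
automatic there, `converges_slotPerm_of_ample`). [BrownZudilin2022, Sect. 7, eq. (27)] -/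
theorem invariance_group_on_ample :
    ∀ (σ : Perm (Fin 7)) (a : Fin 8 → ℤ), Ample a → Converges a → Converges (slotPerm σ a) →
      normalisedIntegral' (slotPerm σ a) = normalisedIntegral' a :=
  fun σ _ hA _ _ => normalisedIntegral'_slotPerm_of_ample σ hA

/-- The normalised integral is constant on the orbit of an ample vector. -/
theorem normalisedIntegral'_orbit_const (σ τ : Perm (Fin 7)) {a : Fin 8 → ℤ} (hA : Ample a) :
    normalisedIntegral' (slotPerm σ a) = normalisedIntegral' (slotPerm τ a) := by
  rw [normalisedIntegral'_slotPerm_of_ample σ hA, normalisedIntegral'_slotPerm_of_ample τ hA]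

/-- The record direction `(8,16,10,15,12,16,18,13)` [BrownZudilin2022, Sect. 11] is ample, hence (27) holds on its whole orbit. -/
theorem record_orbit_invariant (σ : Perm (Fin 7)) :
    Ample recordVec ∧ normalisedIntegral' (slotPerm σ recordVec) = normalisedIntegral' recordVec :=
  have hA : Ample recordVec := by decide
  ⟨hA, normalisedIntegral'_slotPerm_of_ample σ hA⟩

/-- denom-theory-d3 g27's vector `x = (17,0,8,1,6,2,0,5)` converges but is NOT ample (its orbit is not wholly convergent):
the ample locus is a proper part of the convergent one. -/
theorem converges_not_ample_example : Converges ![17, 0, 8, 1, 6, 2, 0, 5] ∧ ¬ Ample ![17, 0, 8, 1, 6, 2, 0, 5] := by decide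

/-! ### 5. The `G`-fixed direction `𝟙 = (1,…,1)`: translation makes every vector ample -/

/-- The translation of the dual parameters induced by `a ↦ a + c·𝟙`: `b₀ ↦ b₀ + 3c`, `b_j ↦ b_j + c` (`1 ≤ j ≤ 7`),
nothing beyond slot `7`. -/
def shiftB (c : ℤ) (j : ℕ) : ℤ := if j = 0 then 3 * c else if j ≤ 7 then c else 0

/-- `b(a + c·𝟙) = b(a) + shiftB c`. -/
theorem bOfA_add_const (a : Fin 8 → ℤ) (c : ℤ) : bOfA (fun i => a i + c) = fun j => bOfA a j + shiftB c j := by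
  funext j
  unfold bOfA shiftB
  rcases j with _ | _ | _ | _ | _ | _ | _ | _ | j
  all_goals simp
  all_goals ring

/-- `a(b + shiftB c) = a(b) + c·𝟙`. -/
theorem aOfB_add_shiftB (b : ℕ → ℤ) (c : ℤ) : aOfB (fun j => b j + shiftB c j) = fun i => aOfB b i + c := by
  funext i
  fin_cases i <;> simp [aOfB, shiftB] <;> ring

/-- `permB σ` commutes with the translation `shiftB c` (which is constant on the permuted slots `1,…,7`). -/
theorem permB_add_shiftB (σ : Perm (Fin 7)) (b : ℕ → ℤ) (c : ℤ) :
    permB σ (fun j => b j + shiftB c j) = fun j => permB σ b j + shiftB c j := by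
  funext j
  unfold permB
  split_ifs with h1
  · have hk := (σ.symm ⟨j - 1, by omega⟩).isLt
    have e1 : shiftB c ((σ.symm ⟨j - 1, by omega⟩ : ℕ) + 1) = c := by
      unfold shiftB; rw [if_neg (by omega), if_pos (by omega)]
    have e2 : shiftB c j = c := by unfold shiftB; rw [if_neg (by omega), if_pos (by omega)]
    dsimp only
    rw [e1, e2]
  · rfl

/-- **`σ·(a + c·𝟙) = σ·a + c·𝟙`**: the translation by the `G`-fixed direction `(1,…,1)` commutes with every `slotPerm σ`
(`slotPerm` is affine-linear and `σ·𝟙 = 𝟙`). [BrownZudilin2022, Sect. 8] -/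
theorem slotPerm_add_const (σ : Perm (Fin 7)) (a : Fin 8 → ℤ) (c : ℤ) :
    slotPerm σ (fun i => a i + c) = fun i => slotPerm σ a i + c := by
  rw [slotPerm_def, slotPerm_def, bOfA_add_const, permB_add_shiftB, aOfB_add_shiftB]

/-- **`h_i(a + c·𝟙) = h_i(a) + c`** for each of the 28 forms (26). -/
theorem hForm_add_const (a : Fin 8 → ℤ) (c : ℤ) (i : ℕ) (hi : 1 ≤ i) (hi' : i ≤ 28) :
    hForm (fun k => a k + c) i = hForm a i + c := by
  interval_cases i <;> simp [hForm, hList] <;> ring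

/-- **Translation by `c·𝟙` with `c ≥ -h_i(a)` for all `i` makes `a` ample** (all 28 forms move up by `c`). -/
theorem ample_add_const {a : Fin 8 → ℤ} {c : ℤ} (hc : ∀ x ∈ hList a, -c ≤ x) : Ample (fun i => a i + c) := by
  simp only [hList, List.mem_cons, List.not_mem_nil, or_false, forall_eq_or_imp, forall_eq] at hc
  rw [ample_iff]
  omega

/-- In particular `a + c·𝟙` is ample for every integer `c` at least the sum of the absolute values of the 28 forms of `a`
(a convenient explicit threshold). -/
theorem ample_add_const_of_le {a : Fin 8 → ℤ} {c : ℤ} (hc : ((((hList a).map Int.natAbs).sum : ℕ) : ℤ) ≤ c) :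
    Ample (fun i => a i + c) := by
  apply ample_add_const
  intro x hx
  have h1 : x.natAbs ≤ ((hList a).map Int.natAbs).sum := List.le_sum_of_mem (List.mem_map.2 ⟨x, hx, rfl⟩)
  omega

end Summit.KontsevichZagierPeriods.Zeta5Search.AmpleGroupInvariance
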